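import Summits.NavierStokesRegularity.FluidComputer.PalasekTowerBurgersNumberStrain
import Summits.NavierStokesRegularity.FluidComputer.PalasekTowerRadialChildRelaxation

/-!
# REGISTER v2.3″ (continued): the relaxation clock of a radial child is the compaction clock plus
# `log(1/ε)` strain times — a `k`-uniform fraction of the rigid window

Cell `ns-blowup`, seat `ns-blowup-ecbridge-8` (g7); evidence toward crux 19250 `HeredityFromTwo`
(window ceiling / floors), route `PalasekTowerBreakdown`, MODEL lane. `PalasekTowerRadialChildRelaxation`
(ecbridge-8 g7) proves that a RADIAL child core handed over with seed profile `ω₀` (mass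
`N₁ = ∫|ω₀|`, second moment `N₂ = ∫|y|²|ω₀|`) is pinned at the relaxing Burgers vortex within `1 ± ε`
once `λA_k t ≥ log(1 + λA_kN₂/(2εN₁))` (`…_radialChild_relaxation_clock`, `…_peak_pinned`,
`…_maxSwirl_floor/ceiling`). `PalasekTowerBurgersNumberStrain` §4 (ecbridge-8 g3) priced the
KINEMATIC compaction of a parent-scale seed `r₀ = 1/N_k` to the Burgers radius `(λA_k)^{−1/2}`:
`t_c = ((β − 2) ln N_k + ln λ)/(λA_k)` (`_compaction_clock`), `= (β − 2)/(4b²β)·w_k` of the growth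
window `w_k = 4bβ log N_{k+1}/A_k` at `λ = 1` (`_compaction_clock_window`), `< (τ_{k+1} − τ_k)/37` on
the wide rates under `Schedule.Rigid` (`_compaction_clock_rigid`). This file reads the relaxation
clock in the same units, for a seed NO FATTER THAN THE PARENT CORE SCALE (`N₂ ≤ N₁/N_k²`: radius of
gyration `≤ 1/N_k`, i.e. effective core parameter `s_eff(0) ≤ 1/(4N_k²)`):

* `palasekTowerBreakdown_relaxation_seed_parentScale` — for such a seed the clock argument is
  `≤ λN_k^{β−2}/(2ε)` (`λA_k/N_k² = λN_k^{β−2}`, `A_k = N_k^β`);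
* **`palasekTowerBreakdown_relaxation_clock_le_compaction_add`** — for `λ ≥ 1`, `0 < ε ≤ 1/2`:
  `log(1 + λN_k^{β−2}/(2ε))/(λA_k) ≤ t_c + log(1/ε)/(λA_k)` — THE RELAXATION CLOCK IS THE
  COMPACTION CLOCK PLUS `log(1/ε)` STRAIN TIMES (`log(1 + x) ≤ log(2x)` for `x ≥ 1`);
* **`palasekTowerBreakdown_relaxation_clock_rigid`** — wide rates, `Schedule.Rigid`, `λ = 1`:
  `log(1 + N_k^{β−2}/(2ε))/A_k < (τ_{k+1} − τ_k)/37 + log(1/ε)/A_k` — a `k`-UNIFORM budget: the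
  first term is the compaction fraction `75/2783 < 1/37` of the window, the second is
  `log(1/ε)/(4bβ log N_{k+1})` of it and DECREASES with `k` (at `k = 2`, `ε = 1/50`:
  `3.9/74.7 ≈ 5 %`; window `= 4bβ log N_{k+1} ≈ 74.7` strain times);
* **`palasekTowerBreakdown_radialChild_peak_pinned_of_parentScale`** — consequence: a co-signed
  radial seed of radius of gyration `≤ 1/N_k`, carried by the host strain `λA_k` (`λ ≥ 1`), has its
  axial vorticity pinned at the relaxing Burgers peak within `1 ± ε` (everywhere from above, on the
  axis from below) at every time `t ≥ t_c + log(1/ε)/(λA_k)` of the run-up — i.e., on the wide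
  rigid register at `λ = 1`, from `τ_k + (τ_{k+1} − τ_k)/37 + log(1/ε)/A_k` on, for EVERY seed profile.

Reading (numbers, not adjectives; wide rates `N₀ = 256`, `b = 11/10`, `β = 23/10`, `k = 2`):
`A_2 w_2 = 4bβ log N_3 ≈ 74.7` strain times per window; compaction `(β−2) log N_2 ≈ 2.0`;
relaxation to `ε = 1/10 / 1/50 / 1/100`: `≤ 2.0 + 2.3 / 3.9 / 4.6` strain times, after which the sharp
Burgers readings (`PalasekTowerBurgersNumber`, band width exactly `c₂/c₁ = 5/3`) hold for the child
of ANY radial seed profile up to `1 ± ε` (`…RadialChildRelaxation` v3: max swirl certified in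
`[0.0487, 0.0626]·Γ(λA_k/ν_t)^{1/2}` at `ε = 1/50`).

WHAT THIS IS NOT: not NS about any registered flow — exact infinite-energy strained eddies (MB Ex.
2.9) under the MODEL identification «child core = radial cross-section carried by the host strain»;
nothing is asserted about `WindowCeilingAt`, `AprioriCeiling`, the floors or any crux; non-radial
seeds (Gallay–Wayne 2005) not covered.

References: A. J. Majda, A. L. Bertozzi, CUP 2002, §2.3.3 Example 2.9 (2.71)–(2.73)
[cite: MajdaBertozziCUP2002, §2.3.3 Example 2.9 eqs. (2.71)–(2.72)]; P. G. Saffman, *Vortex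
Dynamics*, CUP 1992, §13.3 (26)–(27) [cite: Saffman1992, §13.3 eq. (12)]; S. Palasek,
arXiv:2605.13827, §3.3 (the `4bβ` window) [cite: Palasek2026ElementaryModel, §3 (3.2)].
-/

namespace Summit.NavierStokesRegularity.FluidComputer.PalasekTowerClayBridge

open Real Set MeasureTheory
open Literature.Analysis.FluidPDE Literature.Analysis.FluidPDE.RadialEddy

variable {ω₀ : EuclideanSpace ℝ (Fin 2) → ℝ}

/-- `λA_k/N_k² = λN_k^{β−2}` (`A_k = N_k^β`). -/
theorem palasekTowerBreakdown_A_div_N_sq (R : TowerRates) (k : ℕ) (l : ℝ) :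
    l * R.A k / R.N k ^ 2 = l * R.N k ^ (R.β - 2) := by
  have hN := R.N_pos k
  rw [TowerRates.A, Real.rpow_sub hN, Real.rpow_two]
  ring

/-- **A seed no fatter than the parent core scale**: if `∫|y|²|ω₀| ≤ N_k⁻²·∫|ω₀|` (radius of
gyration `≤ 1/N_k`) then the relaxation-clock argument satisfies
`λA_k·N₂/(2εN₁) ≤ λN_k^{β−2}/(2ε)` (`N₁ = ∫|ω₀| > 0`, `ε, λ > 0`). -/
theorem palasekTowerBreakdown_relaxation_seed_parentScale (R : TowerRates) (k : ℕ) {l ε : ℝ}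
    (hl : 0 < l) (hε : 0 < ε) (hN : 0 < ∫ y, |ω₀ y|)
    (hseed : (∫ y, ‖y‖ ^ 2 * |ω₀ y|) ≤ (R.N k)⁻¹ ^ 2 * ∫ y, |ω₀ y|) :
    l * R.A k * (∫ y, ‖y‖ ^ 2 * |ω₀ y|) / (2 * ε * ∫ y, |ω₀ y|) ≤
      l * R.N k ^ (R.β - 2) / (2 * ε) := by
  have hA := R.A_pos k
  have hNk := R.N_pos k
  rw [← palasekTowerBreakdown_A_div_N_sq R k l, div_le_iff₀ (by positivity)]
  calc l * R.A k * ∫ y, ‖y‖ ^ 2 * |ω₀ y|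
      ≤ l * R.A k * ((R.N k)⁻¹ ^ 2 * ∫ y, |ω₀ y|) := mul_le_mul_of_nonneg_left hseed (by positivity)
    _ = l * R.A k / R.N k ^ 2 / (2 * ε) * (2 * ε * ∫ y, |ω₀ y|) := by
        field_simp

/-- **THE RELAXATION CLOCK IS THE COMPACTION CLOCK PLUS `log(1/ε)` STRAIN TIMES** (`λ ≥ 1`,
`0 < ε ≤ 1/2`): `log(1 + λN_k^{β−2}/(2ε))/(λA_k) ≤ ((β − 2) log N_k + log λ)/(λA_k) + log(1/ε)/(λA_k)`
— the first summand is the kinematic compaction time `t_c` of `PalasekTowerBurgersNumberStrain`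
(`_compaction_clock`: `= (2/λA_k) log(√(λA_k)/N_k)`); since `x = λN_k^{β−2}/(2ε) ≥ 1`,
`log(1 + x) ≤ log(2x) = (β − 2) log N_k + log λ + log(1/ε)`. -/
theorem palasekTowerBreakdown_relaxation_clock_le_compaction_add (R : TowerRates) (k : ℕ) {l ε : ℝ}
    (hl : 1 ≤ l) (hε : 0 < ε) (hε2 : ε ≤ 1 / 2) :
    Real.log (1 + l * R.N k ^ (R.β - 2) / (2 * ε)) / (l * R.A k) ≤
      ((R.β - 2) * Real.log (R.N k) + Real.log l) / (l * R.A k) + Real.log (1 / ε) / (l * R.A k) := by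
  have hA := R.A_pos k
  have hNk := R.N_pos k
  have hl0 : 0 < l := lt_of_lt_of_le one_pos hl
  have hβ : 0 < R.β - 2 := by linarith [R.two_lt_β]
  -- `x = λ N^{β-2}/(2ε) ≥ 1`
  have hP : 1 < R.N k ^ (R.β - 2) := Real.one_lt_rpow (R.one_lt_N k) hβ
  have hP0 : 0 < R.N k ^ (R.β - 2) := by positivity
  set x : ℝ := l * R.N k ^ (R.β - 2) / (2 * ε) with hx
  have hx1 : 1 ≤ x := by
    rw [hx, le_div_iff₀ (by positivity)]
    nlinarith
  have hx0 : 0 < x := lt_of_lt_of_le one_pos hx1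
  -- `log(1 + x) ≤ log(2x) = log(λ N^{β-2}/ε) = (β-2) log N + log λ + log(1/ε)`
  have hlog : Real.log (1 + x) ≤ Real.log (2 * x) :=
    Real.log_le_log (by positivity) (by linarith)
  have h2x : 2 * x = l * R.N k ^ (R.β - 2) * (1 / ε) := by rw [hx]; field_simp
  have hsplit : Real.log (2 * x) = (R.β - 2) * Real.log (R.N k) + Real.log l + Real.log (1 / ε) := by
    rw [h2x, Real.log_mul (by positivity) (by positivity), Real.log_mul hl0.ne' hP0.ne',
      Real.log_rpow hNk]
    ring
  rw [← add_div, div_le_div_iff_of_pos_right (by positivity)]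
  calc Real.log (1 + x) ≤ Real.log (2 * x) := hlog
    _ = (R.β - 2) * Real.log (R.N k) + Real.log l + Real.log (1 / ε) := hsplit

/-- **ON THE WIDE RIGID REGISTER (`λ = 1`) THE RELAXATION CLOCK IS `< (τ_{k+1} − τ_k)/37 + log(1/ε)/A_k`**,
for every `k` and every `0 < ε ≤ 1/2` — the compaction fraction `75/2783 < 1/37` of the window
(`_compaction_fraction_wide`, `_rigid_window`) plus `log(1/ε)` strain times; a `k`-UNIFORM budget
out of a window of `A_k(τ_{k+1} − τ_k) = 4bβ log N_{k+1}` strain times (`≈ 74.7` at `k = 2`). -/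
theorem palasekTowerBreakdown_relaxation_clock_rigid (S : Schedule TowerRates.wide) (hS : S.Rigid)
    (k : ℕ) {ε : ℝ} (hε : 0 < ε) (hε2 : ε ≤ 1 / 2) :
    Real.log (1 + TowerRates.wide.N k ^ (TowerRates.wide.β - 2) / (2 * ε)) / TowerRates.wide.A k <
      (S.τ (k + 1) - S.τ k) / 37 + Real.log (1 / ε) / TowerRates.wide.A k := by
  have h := palasekTowerBreakdown_relaxation_clock_le_compaction_add TowerRates.wide k le_rfl hε hε2
  rw [one_mul, one_mul, Real.log_one, add_zero] at h
  have hc : (TowerRates.wide.β - 2) * Real.log (TowerRates.wide.N k) / TowerRates.wide.A k <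
      (S.τ (k + 1) - S.τ k) / 37 := by
    rw [palasekTowerBreakdown_compaction_clock_window, palasekTowerBreakdown_rigid_window hS k]
    obtain ⟨h1, h2⟩ := palasekTowerBreakdown_compaction_fraction_wide
    rw [h1]
    have hw : 0 < TowerRates.wide.window k := TowerRates.wide.window_pos k
    rw [lt_div_iff₀ (by norm_num : (0 : ℝ) < 37)]
    nlinarith
  linarith

/-- **A CO-SIGNED RADIAL SEED OF RADIUS OF GYRATION `≤ 1/N_k` IS BURGERS-PINNED FROM
`t_c + log(1/ε)/(λA_k)` ON** (`ν = 1`, host strain `λA_k`, `λ ≥ 1`, `0 < ε ≤ 1/2`): for an even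
seed `ω₀ ≥ 0`, `ω₀ ∈ L¹`, `Γ = ∫ω₀ > 0`, `∫|y|²ω₀ ≤ Γ/N_k²`, at every time
`t ≥ ((β − 2) log N_k + log λ)/(λA_k) + log(1/ε)/(λA_k)` the child's axial vorticity is
`≤ (1 + ε)·ΓλA_k/(4π(1 − e^{−λA_k t}))` EVERYWHERE and `≥ (1 − ε)·ΓλA_k/(4π(1 − e^{−λA_k t}))` ON
THE AXIS (`…_radialChild_peak_pinned` with the clock discharged by
`_relaxation_seed_parentScale` + `_relaxation_clock_le_compaction_add`); on the wide rigid register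
at `λ = 1` this holds from `τ_k + (τ_{k+1} − τ_k)/37 + log(1/ε)/A_k` on (`_relaxation_clock_rigid`). -/
theorem palasekTowerBreakdown_radialChild_peak_pinned_of_parentScale (R : TowerRates) (k : ℕ)
    {l : ℝ} (hl : 1 ≤ l) (hω₀ : Integrable ω₀) (h2 : Integrable fun y => ‖y‖ ^ 2 * |ω₀ y|)
    (heven : ∀ y, ω₀ (-y) = ω₀ y) (hnn : ∀ y, 0 ≤ ω₀ y) (hΓ : 0 < ∫ y, ω₀ y)
    (hseed : (∫ y, ‖y‖ ^ 2 * |ω₀ y|) ≤ (R.N k)⁻¹ ^ 2 * ∫ y, ω₀ y)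
    {ε : ℝ} (hε : 0 < ε) (hε2 : ε ≤ 1 / 2) {t : ℝ}
    (ht : ((R.β - 2) * Real.log (R.N k) + Real.log l) / (l * R.A k) +
      Real.log (1 / ε) / (l * R.A k) ≤ t) :
    (∀ x : EuclideanSpace ℝ (Fin 2), strainedEddyVorticity (l * R.A k) 1 ω₀ t x ≤
        (1 + ε) * ((∫ y, ω₀ y) * (l * R.A k / (4 * π * (1 - exp (-(l * R.A k * t))))))) ∧
      (1 - ε) * ((∫ y, ω₀ y) * (l * R.A k / (4 * π * (1 - exp (-(l * R.A k * t)))))) ≤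
        strainedEddyVorticity (l * R.A k) 1 ω₀ t 0 := by
  have hl0 : 0 < l := lt_of_lt_of_le one_pos hl
  have hγ : 0 < l * R.A k := mul_pos hl0 (R.A_pos k)
  -- co-signed: `N₁ = Γ`
  have hN1 : (∫ y, |ω₀ y|) = ∫ y, ω₀ y :=
    integral_congr_ae (Filter.Eventually.of_forall fun y => abs_of_nonneg (hnn y))
  have hN : 0 < ∫ y, |ω₀ y| := by rw [hN1]; exact hΓ
  have hseed' : (∫ y, ‖y‖ ^ 2 * |ω₀ y|) ≤ (R.N k)⁻¹ ^ 2 * ∫ y, |ω₀ y| := by rw [hN1]; exact hseed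
  -- the clock: `log(1 + λA_k N₂/(2εΓ)) ≤ log(1 + λN^{β-2}/(2ε)) ≤ λA_k t`
  have hbound := palasekTowerBreakdown_relaxation_clock_le_compaction_add R k hl hε hε2
  have hT : Real.log (1 + l * R.N k ^ (R.β - 2) / (2 * ε)) ≤ l * R.A k * t := by
    have h1 : Real.log (1 + l * R.N k ^ (R.β - 2) / (2 * ε)) / (l * R.A k) ≤ t := hbound.trans ht
    rw [div_le_iff₀ hγ] at h1
    linarith
  have harg := palasekTowerBreakdown_relaxation_seed_parentScale R k hl0 hε hN hseed'
  have hpos : 0 < 1 + l * R.A k * (∫ y, ‖y‖ ^ 2 * |ω₀ y|) / (2 * ε * ∫ y, |ω₀ y|) := by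
    have : 0 ≤ l * R.A k * (∫ y, ‖y‖ ^ 2 * |ω₀ y|) / (2 * ε * ∫ y, |ω₀ y|) := by
      have : 0 ≤ ∫ y, ‖y‖ ^ 2 * |ω₀ y| := integral_nonneg fun y => by positivity
      positivity
    linarith
  have hclock : Real.log (1 + l * R.A k * (∫ y, ‖y‖ ^ 2 * |ω₀ y|) / (2 * ε * ∫ y, ω₀ y)) ≤
      l * R.A k * t := by
    rw [← hN1]
    exact ((Real.log_le_log hpos (by linarith)).trans hT)
  -- the pin needs `t > 0`: the clock is positive
  have ht0 : 0 < t := by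
    have hA := R.A_pos k
    have hNk := R.N_pos k
    have hβ : 0 < R.β - 2 := by linarith [R.two_lt_β]
    have h1 : 0 < (R.β - 2) * Real.log (R.N k) := mul_pos hβ (R.log_N_pos k)
    have h2 : 0 ≤ Real.log l := Real.log_nonneg hl
    have h3 : 0 ≤ Real.log (1 / ε) := Real.log_nonneg (by rw [le_div_iff₀ hε]; linarith)
    have : 0 < ((R.β - 2) * Real.log (R.N k) + Real.log l) / (l * R.A k) +
        Real.log (1 / ε) / (l * R.A k) := by positivity
    linarith
  exact palasekTowerBreakdown_radialChild_peak_pinned R k hl0 hω₀ h2 heven hnn hΓ hε ht0 hclock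

end Summit.NavierStokesRegularity.FluidComputer.PalasekTowerClayBridge
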